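import Literature.AnabelianGeometry.AbsoluteAnabelian.AbsTopIThm26iiiClauseOneProofs
import Literature.AnabelianGeometry.AbsoluteAnabelian.AbsTopIThm26iiiTransportProofs
import Literature.NumberTheory.GaloisRepresentations.LocalGlobalCohomologyFiniteProofs
import HarnessLib

/-!
# [AbsTopI] Thm 2.6 (iii), first clause, for every open subgroup; `δ²_l(G_K) = 0`

Mochizuki, *Topics in absolute anabelian geometry I: generalities*, J. Math. Sci. Univ. Tokyo
**19** (2012), Theorem 2.6 (iii), proof p. 23 l. 31–41.

Two supplements to `AbsTopIThm26iiiClauseOneProofs`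
(`FundamentalExtension.thetaSet_two_subset_of_isProSet`, the clause `θ²(Π) ⊆ Σ`):

* the input "`δ²_l(G) = 0` for all `l ∈ Primes` [cf., e.g., [NSW], Theorem 7.2.6]" (p. 23
  l. 33–35) as a stand-alone theorem about the typed invariant `deltaInv`: for a finite extension
  `K/ℚ_p`, `δ²_l(G_K) = 0`, `δ²_l(H) = 0` for every open `H ≤ G_K`, hence `ε²_l(G_K) = 0`
  (`deltaInv_two_absoluteGaloisGroup_eq_zero`, `deltaInv_two_eq_zero_of_isOpen_absoluteGaloisGroup`,
  `epsilonInv_two_absoluteGaloisGroup_eq_zero`) — from the finite levels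
  (`exists_nsmul_continuousCohomology_two_zmod_eq_zero`: one `m ≥ 1` kills every `H²(G_K, ℤ/lⁱ)`;
  `finite_galoisCohomology_one_of_isNonarchimedeanLocalField`: `H¹(G_K, ℤ/lⁱ)` finite) and the
  passage `ℤ/lⁱ → ℤ_l → ℚ_l` (`subsingleton_continuousCohomology_two_padic_of_forall_zmod`);
* "By applying the analogue of this conclusion for an arbitrary open subgroup `H ⊆ Π`" (p. 23
  l. 38–39): the first clause of Thm 2.6 (iii) for EVERY open subgroup `H ≤ Π` —
  `θ²(H) ⊆ Σ` (`FundamentalExtension.thetaSet_two_subset_of_isProSet_of_isOpen`,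
  `FundamentalExtension.forall_isOpen_thetaSet_two_subset_of_isProSet`), which is the shape in
  which Thm 2.6 (v) consumes (iii) (`MLFBase.thm26vFull_of_rank_of_thm26iii_open`, hypothesis
  `hiii`, first conjunct).

All groups live in `Type` (universe `0`), as in `AbsTopIThm26iiiClauseOneProofs`.
-/

noncomputable section

open CategoryTheory Function Topology

namespace Literature.AnabelianGeometry.AbsoluteAnabelian

open Literature.NumberTheory.GaloisRepresentations
open _root_.TopRep _root_.ContRepresentation _root_.ContinuousCohomology Field

/-! ### `δ²_l(G_K) = 0` for a finite extension `K/ℚ_p` -/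

/-- **`δ²_l(G_K) = 0`** for a finite extension `K` of `ℚ_p` and every prime `l`
(`δ²_l(G) := dim_{ℚ_l} H²(G, ℚ_l)`): "`δ²_l(G) = 0` for all `l ∈ Primes` [cf., e.g., [NSW],
Theorem 7.2.6]" ([AbsTopI] p. 23).  Proof at finite levels: one `m ≥ 1` kills all
`H²(G_K, ℤ/lⁱ)` (local Tate duality in bidegree `(2,0)` and the finiteness of `μ_{l^∞}(K)`,
`exists_nsmul_continuousCohomology_two_zmod_eq_zero`), `H¹(G_K, ℤ/lⁱ)` is finite
(`finite_galoisCohomology_one_of_isNonarchimedeanLocalField`), so `H²_cont(G_K, ℤ_l)` is killed by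
`m` and `H²_cont(G_K, ℚ_l) = 0` (`subsingleton_continuousCohomology_two_padic_of_forall_zmod`).
[cite: NeukirchSchmidtWingberg2008, Thm 7.2.6] -/
theorem deltaInv_two_absoluteGaloisGroup_eq_zero (p : ℕ) [Fact p.Prime] (K : Type) [Field K]
    [Algebra ℚ_[p] K] [FiniteDimensional ℚ_[p] K] (l : ℕ) [hl : Fact l.Prime] :
    deltaInv (absoluteGaloisGroup K) 2 l = 0 := by
  classical
  obtain ⟨m, hm0, hm⟩ := exists_nsmul_continuousCohomology_two_zmod_eq_zero p K l
  -- the tree's valued model of `K` as a non-archimedean local field of characteristic `0`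
  haveI : IsNonarchimedeanLocalField ℚ_[p] := Padic.isNonarchimedeanLocalField_holds p
  letI := FiniteExtension.valuativeRel ℚ_[p] K
  letI := FiniteExtension.topologicalSpace ℚ_[p] K
  haveI : IsNonarchimedeanLocalField K := FiniteExtension.isNonarchimedeanLocalField ℚ_[p] K
  haveI : CharZero K := charZero_of_injective_algebraMap (algebraMap ℚ_[p] K).injective
  haveI : CompactSpace (absoluteGaloisGroup K) := absoluteGaloisGroup_compactSpace K
  have hfin : ∀ i, Finite (continuousCohomology 1 (zmodRep (absoluteGaloisGroup K) l i)) := by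
    intro i
    haveI : NeZero (l ^ i) := ⟨pow_ne_zero i hl.out.ne_zero⟩
    exact finite_galoisCohomology_one_of_isNonarchimedeanLocalField (F := K)
      (ContinuousRep.trivial (absoluteGaloisGroup K) ℤ (ZMod (l ^ i)))
  haveI := subsingleton_continuousCohomology_two_padic_of_forall_zmod
    (G := absoluteGaloisGroup K) l hfin hm0 hm
  unfold deltaInv
  rw [rank_subsingleton', map_zero]

/-- **`δ²_l(H) = 0` for every open subgroup `H ≤ G_K`** (`K/ℚ_p` finite, `l` any prime): an open
subgroup of `G_K` is `G_{K'}` for a finite extension `K'/K` (`H = Gal(K̄/K') ≅ G_{K'}`,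
`exists_intermediateField_of_isOpen_absoluteGaloisGroup`, `nonempty_continuousMulEquiv_fixingSubgroup`),
and `δ²_l` is an invariant of the topological group. [cite: NeukirchSchmidtWingberg2008, Thm 7.2.6] -/
theorem deltaInv_two_eq_zero_of_isOpen_absoluteGaloisGroup (p : ℕ) [Fact p.Prime] (K : Type)
    [Field K] [Algebra ℚ_[p] K] [FiniteDimensional ℚ_[p] K] (l : ℕ) [Fact l.Prime]
    {H : Subgroup (absoluteGaloisGroup K)} (hH : IsOpen (H : Set (absoluteGaloisGroup K))) :
    deltaInv ↥H 2 l = 0 := by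
  haveI : CharZero K := charZero_of_injective_algebraMap (algebraMap ℚ_[p] K).injective
  obtain ⟨K', hfinK', -, hK'⟩ := exists_intermediateField_of_isOpen_absoluteGaloisGroup K H hH
  haveI := hfinK'
  haveI : FiniteDimensional ℚ_[p] ↥K' := FiniteDimensional.trans ℚ_[p] K ↥K'
  obtain ⟨e⟩ := nonempty_continuousMulEquiv_fixingSubgroup K K'
  subst hK'
  rw [deltaInv_eq_of_continuousMulEquiv e 2 l]
  exact deltaInv_two_absoluteGaloisGroup_eq_zero p ↥K' l

/-- **`ε²_l(G_K) = 0`** (`K/ℚ_p` finite, `l` any prime): `ε²_l` is the supremum of `δ²_l(H)` over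
the open subgroups `H ≤ G_K`, all of which vanish. [cite: NeukirchSchmidtWingberg2008, Thm 7.2.6] -/
theorem epsilonInv_two_absoluteGaloisGroup_eq_zero (p : ℕ) [Fact p.Prime] (K : Type) [Field K]
    [Algebra ℚ_[p] K] [FiniteDimensional ℚ_[p] K] (l : ℕ) [Fact l.Prime] :
    epsilonInv (absoluteGaloisGroup K) 2 l = 0 := by
  refine nonpos_iff_eq_zero.mp ?_
  unfold epsilonInv
  refine iSup₂_le fun H hH => ?_
  rw [deltaInv_two_eq_zero_of_isOpen_absoluteGaloisGroup p K l hH]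

/-! ### Open subgroups of open subgroups -/

/-- An open subgroup `J` of a subgroup `H ≤ G` is isomorphic, as a topological group, to its image
`J ≤ G` under the inclusion `H ↪ G`. [folklore] -/
private theorem nonempty_continuousMulEquiv_map_subtype {G : Type} [Group G] [TopologicalSpace G]
    (H : Subgroup G) (J : Subgroup ↥H) : Nonempty (↥J ≃ₜ* ↥(J.map H.subtype)) := by
  have hmem : ∀ x : ↥J, ((x : ↥H) : G) ∈ J.map H.subtype := fun x =>
    Subgroup.mem_map_of_mem H.subtype x.2
  have hmemH : ∀ y : ↥(J.map H.subtype), (y : G) ∈ H := fun y => by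
    obtain ⟨x, -, hxy⟩ := Subgroup.mem_map.mp y.2
    rw [← hxy]
    exact x.2
  have hmemJ : ∀ y : ↥(J.map H.subtype), (⟨(y : G), hmemH y⟩ : ↥H) ∈ J := fun y => by
    obtain ⟨x, hx, hxy⟩ := Subgroup.mem_map.mp y.2
    have h : (⟨(y : G), hmemH y⟩ : ↥H) = x := Subtype.ext (by rw [← hxy]; rfl)
    rw [h]
    exact hx
  refine ⟨{ toFun := fun x => ⟨((x : ↥H) : G), hmem x⟩
            invFun := fun y => ⟨⟨(y : G), hmemH y⟩, hmemJ y⟩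
            left_inv := fun x => rfl
            right_inv := fun y => rfl
            map_mul' := fun x y => rfl
            continuous_toFun := ?_
            continuous_invFun := ?_ }⟩
  · exact (continuous_subtype_val.comp continuous_subtype_val).subtype_mk _
  · exact (continuous_subtype_val.subtype_mk _).subtype_mk _

/-- The image in `G` of an open subgroup of an open subgroup `H ≤ G` is open. [folklore] -/
private theorem isOpen_map_subtype {G : Type} [Group G] [TopologicalSpace G] {H : Subgroup G}
    (hH : IsOpen (H : Set G)) {J : Subgroup ↥H} (hJ : IsOpen (J : Set ↥H)) :
    IsOpen ((J.map H.subtype : Subgroup G) : Set G) := by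
  rw [Subgroup.coe_map, Subgroup.coe_subtype]
  exact hH.isOpenEmbedding_subtypeVal.isOpenMap _ hJ

namespace FundamentalExtension

variable (E : FundamentalExtension.{0})

/-! ### Thm 2.6 (iii), first clause, for every open subgroup `H ≤ Π` -/

/-- **`δ²_l(J) = 0` for every open subgroup `J` of an open subgroup `H ≤ Π`** and every prime
`l ∉ Σ` (`G ≅ G_K` with `K` an MLF, `Π` topologically finitely generated, `Δ` pro-`Σ`): `J` is an
open subgroup of `Π` (p. 23: "By applying the analogue of this conclusion for an arbitrary open
subgroup `H ⊆ Π`, we thus obtain that `δ²_l(H) = 0` if `l ∉ Σ`").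
[cite: MochizukiAbsTopI2012, Thm 2.6 (iii) proof p.23] -/
theorem deltaInv_two_eq_zero_of_isProSet_of_isOpen (B : E.MLFBase) {S : Set ℕ}
    (htfg : IsTopologicallyFinitelyGenerated E.arith) (hpro : IsProSet E.geom S) {l : ℕ}
    [Fact l.Prime] (hlS : l ∉ S) {H : Subgroup E.arith} (hH : IsOpen (H : Set E.arith))
    {J : Subgroup ↥H} (hJ : IsOpen (J : Set ↥H)) : deltaInv ↥J 2 l = 0 := by
  obtain ⟨e⟩ := nonempty_continuousMulEquiv_map_subtype H J
  rw [deltaInv_eq_of_continuousMulEquiv e 2 l]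
  exact E.deltaInv_two_eq_zero_of_isProSet B htfg hpro hlS (isOpen_map_subtype hH hJ)

/-- **[AbsTopI] Thm 2.6 (iii), first clause, for an open subgroup: `θ²(H) ⊆ Σ`** for every open
`H ≤ Π` — extension `1 → Δ → Π → G → 1` with `G ≅ G_K` (`K` an MLF), `Π` topologically finitely
generated, `Δ` pro-`Σ`.  (`ε²_l(H) = sup_J δ²_l(J) = 0` for `l ∉ Σ`, the `J ≤ H` open being open in
`Π`.) [cite: MochizukiAbsTopI2012, Thm 2.6 (iii) p.22] -/
theorem thetaSet_two_subset_of_isProSet_of_isOpen (B : E.MLFBase) {S : Set ℕ}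
    (htfg : IsTopologicallyFinitelyGenerated E.arith) (hpro : IsProSet E.geom S)
    {H : Subgroup E.arith} (hH : IsOpen (H : Set E.arith)) :
    thetaSet ↥H 2 ⊆ {l ∈ S | l.Prime} := by
  intro l hl
  obtain ⟨hlp, hle⟩ := hl
  refine ⟨?_, hlp⟩
  by_contra hlS
  haveI : Fact l.Prime := ⟨hlp⟩
  have h0 : epsilonInv ↥H 2 l = 0 := by
    refine nonpos_iff_eq_zero.mp ?_
    unfold epsilonInv
    refine iSup₂_le fun J hJ => ?_
    rw [E.deltaInv_two_eq_zero_of_isProSet_of_isOpen B htfg hpro hlS hH hJ]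
  have h1 : ((3 - 2 : ℕ) : ℕ∞) ≤ 0 := h0 ▸ hle
  norm_num at h1

/-- **[AbsTopI] Thm 2.6 (iii), first clause, for all open subgroups at once** — the first
conjunct of the hypothesis `hiii` of the Thm 2.6 (v) closer
`MLFBase.thm26vFull_of_rank_of_thm26iii_open`: `∀ H ≤ Π` open, `θ²(H) ⊆ Σ`.
[cite: MochizukiAbsTopI2012, Thm 2.6 (iii) p.22] -/
theorem forall_isOpen_thetaSet_two_subset_of_isProSet (B : E.MLFBase) {S : Set ℕ}
    (htfg : IsTopologicallyFinitelyGenerated E.arith) (hpro : IsProSet E.geom S) :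
    ∀ H : Subgroup E.arith, IsOpen (H : Set E.arith) → thetaSet ↥H 2 ⊆ {l ∈ S | l.Prime} :=
  fun _ hH => E.thetaSet_two_subset_of_isProSet_of_isOpen B htfg hpro hH

/-! ### What remains of Thm 2.6 (iii) once the first clause is proved -/

/-- **Residual form of [AbsTopI] Thm 2.6 (iii).** Under the hypotheses of the first clause
(`G ≅ G_K` with `K` an MLF, `Π` topologically finitely generated, `Δ` pro-`Σ`) the typed
predicate `E.Thm26iii S` is equivalent to the bare reverse inclusion of its second clause,
"`|θ¹(Π)| ≥ 2 ⟹ Σ ⊆ θ²(Π)`" — the content of the injections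
`H¹(G, Hom(R_l, ℚ_l)) ↪ H²(Π, ℚ_l)`, `l ∈ Σ`, of Lemma 2.7 (iii) (p. 23 l. 36–37, l. 41 ff.).
[cite: MochizukiAbsTopI2012, Thm 2.6 (iii) p.22] -/
theorem thm26iii_iff_of_isProSet (B : E.MLFBase) {S : Set ℕ}
    (htfg : IsTopologicallyFinitelyGenerated E.arith) (hpro : IsProSet E.geom S) :
    E.Thm26iii S ↔
      (2 ≤ (thetaSet E.arith 1).encard → {l ∈ S | l.Prime} ⊆ thetaSet E.arith 2) := by
  have h1 : thetaSet E.arith 2 ⊆ {l ∈ S | l.Prime} := E.thetaSet_two_subset_of_isProSet B htfg hpro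
  unfold Thm26iii
  constructor
  · rintro ⟨-, h2⟩ hθ
    rw [h2 hθ]
  · intro h
    exact ⟨h1, fun hθ => Set.Subset.antisymm h1 (h hθ)⟩

/-- **The typed predicate `Thm26iii E S` is not monotone in `S`.**  `IsProSet E.geom S` is only an
UPPER bound on the primes of `Δ` (it persists for `insert l₁ S`), whereas `θ²(Π)` is intrinsic to
`Π`: under the hypotheses of the first clause and `|θ¹(Π)| ≥ 2`, the predicate FAILS for
`insert l₁ S` for every prime `l₁ ∉ S` (by the first clause for `S`, `l₁ ∉ θ²(Π)`).  In print
`Σ` is pinned by `Δ := Δ_X^Σ`, the maximal pro-`Σ` quotient of the geometric fundamental group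
(p. 21), so every prime of `Σ` occurs in `Δ`; a discharge of the second clause must use such a
pinning (and the geometric origin of `Π`, Lemma 2.7 (iii)).
[cite: MochizukiAbsTopI2012, Thm 2.6 (iii) p.22] -/
theorem not_thm26iii_insert_of_isProSet (B : E.MLFBase) {S : Set ℕ}
    (htfg : IsTopologicallyFinitelyGenerated E.arith) (hpro : IsProSet E.geom S)
    (hθ : 2 ≤ (thetaSet E.arith 1).encard) {l₁ : ℕ} (hl₁ : l₁.Prime) (hl₁S : l₁ ∉ S) :
    ¬ E.Thm26iii (insert l₁ S) := by
  intro h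
  have hmem : l₁ ∈ thetaSet E.arith 2 := by
    rw [h.2 hθ]
    exact ⟨Set.mem_insert l₁ S, hl₁⟩
  exact hl₁S (E.thetaSet_two_subset_of_isProSet B htfg hpro hmem).1

end FundamentalExtension

end Literature.AnabelianGeometry.AbsoluteAnabelian

end
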